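import Literature.Analysis.FluidPDE.WholeSpaceSobolevInterpolation
import Literature.Analysis.FunctionSpaces.SobolevImbeddingSup
import Mathlib.MeasureTheory.Measure.Haar.NormedSpace
import HarnessLib

/-!
# The Gagliardo–Nirenberg inequality `‖∇h‖_∞ ≤ C ‖h‖_{L²}^{1/6} ‖D³h‖_{L²}^{5/6}` on a three-dimensional space

Analysis/FluidPDE support file (everything proved; no definitions, no named facts). For a `C³` field `h`
on a three-dimensional real inner product space `E` (Lebesgue measure `volume`) with values in a real inner
product space, with `h, Dh, D²h, D³h ∈ L²`, the gradient is bounded pointwise by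
`‖∇h(x)‖ ≤ C ‖h‖_{L²}^{1/6} ‖D³h‖_{L²}^{5/6}` with a constant `C = C(E)` — Nirenberg's inequality
(1959, Lecture II) with `j = 1`, `p = ∞`, `m = 3`, `r = q = 2`, `n = 3`, `a = 5/6`; it is display (1.10) of
claim C17 `Chae2007` of the cell `ns-claims` (D-0090), used there at every time slice (Step 11). Proof, as in
every textbook: the inhomogeneous Sobolev imbedding `H² ⊂ C_B` in dimension three
(`FunctionSpaces.exists_enorm_le_sobolev_two_two_dim_three`, PROVED in the tree) applied to `∇h`, the
integer-order interpolation inequalities `‖Dh‖₂² ≤ 3‖h‖₂‖D²h‖₂`, `‖D²h‖₂² ≤ 9‖Dh‖₂‖D³h‖₂`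
(`WholeSpaceSobolevInterpolation.lean`), and optimisation over the dilations `x ↦ h(λx)`.

* `norm_iteratedFDeriv_comp_smul` — `‖Dⁱ(h ∘ (c • ·))(x)‖ = |c|ⁱ ‖Dⁱh(cx)‖`;
* `integral_norm_iteratedFDeriv_comp_smul_sq` — `∫ ‖Dⁱ(h ∘ (c • ·))‖² = c^{2i−3} ∫ ‖Dⁱh‖²` (`c > 0`);
* `exists_norm_fderiv_le_add_dim_three` — `‖∇h(x)‖ ≤ K (‖Dh‖₂ + ‖D²h‖₂ + ‖D³h‖₂)`;
* `exists_norm_fderiv_le_gagliardoNirenberg_dim_three` — **`‖∇h(x)‖ ≤ C ‖h‖₂^{1/6} ‖D³h‖₂^{5/6}`**.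

## Mathlib / tree search
Mathlib: `MeasureTheory.Measure.integral_comp_smul` (dilations under Haar measure),
`ContinuousLinearMap.iteratedFDeriv_comp_right`, the Gagliardo–Nirenberg–SOBOLEV inequality for compactly
supported functions (`eLpNorm_le_eLpNorm_fderiv_of_eq`) but no sup-norm interpolation inequality. Tree:
`exists_enorm_le_sobolev_two_two_dim_three` (`SobolevImbeddingSup`), `WholeSpaceSobolevInterpolation`.

## References
* L. Nirenberg, *On elliptic partial differential equations*, Ann. Sc. Norm. Super. Pisa 13 (1959), Lecture II,
  Theorem p. 125 (the interpolation inequalities). [Nirenberg1959]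
* R. A. Adams, J. J. F. Fournier, *Sobolev Spaces*, 2nd ed. (2003), Thm. 5.2, Thm. 5.8. [AdamsFournier2003]
-/

noncomputable section

open MeasureTheory Set Function Filter Topology InnerProductSpace
open scoped RealInnerProductSpace ENNReal NNReal

namespace Literature.Analysis.FluidPDE

variable {E : Type*} [NormedAddCommGroup E] [InnerProductSpace ℝ E] [FiniteDimensional ℝ E]
  [MeasurableSpace E] [BorelSpace E]
variable {F' : Type*} [NormedAddCommGroup F'] [InnerProductSpace ℝ F']

/-! ### Dilations -/

omit [FiniteDimensional ℝ E] [MeasurableSpace E] [BorelSpace E] in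
/-- `Dⁱ(h ∘ (c • ·))(x) = cⁱ • Dⁱh(c • x)` as multilinear maps, hence `‖Dⁱ(h ∘ (c • ·))(x)‖ = |c|ⁱ ‖Dⁱh(cx)‖`.
[cite: AdamsFournier2003, Thm. 5.8 (proof, dilation step)] -/
theorem norm_iteratedFDeriv_comp_smul {h : E → F'} {n : WithTop ℕ∞} (hh : ContDiff ℝ n h) (c : ℝ)
    (x : E) {i : ℕ} (hi : (i : WithTop ℕ∞) ≤ n) :
    ‖iteratedFDeriv ℝ i (fun y => h (c • y)) x‖ = |c| ^ i * ‖iteratedFDeriv ℝ i h (c • x)‖ := by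
  have hcomp : (fun y => h (c • y)) = h ∘ (c • ContinuousLinearMap.id ℝ E) := by
    funext y; simp
  rw [hcomp, ContinuousLinearMap.iteratedFDeriv_comp_right _ hh x hi]
  have hcx : (c • ContinuousLinearMap.id ℝ E) x = c • x := by simp
  rw [hcx]
  have heq : (iteratedFDeriv ℝ i h (c • x)).compContinuousLinearMap (fun _ => c • ContinuousLinearMap.id ℝ E)
      = (c ^ i) • iteratedFDeriv ℝ i h (c • x) := by
    ext v
    simp only [ContinuousMultilinearMap.compContinuousLinearMap_apply,
      ContinuousLinearMap.coe_id', id_eq, smul_apply]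
    rw [show (fun j => c • v j) = fun j => (fun _ : Fin i => c) j • v j from rfl,
      ContinuousMultilinearMap.map_smul_univ]
    simp [Finset.prod_const, Finset.card_univ, Fintype.card_fin]
  rw [heq, norm_smul, norm_pow, Real.norm_eq_abs]

/-- **`L²` norms of derivatives under dilation** (three dimensions): for `c > 0`,
`∫ ‖Dⁱ(h ∘ (c • ·))‖² = c^{2i} c^{-3} ∫ ‖Dⁱh‖²`. [cite: AdamsFournier2003, Thm. 5.8 (proof, dilation step)] -/
theorem integral_norm_iteratedFDeriv_comp_smul_sq (hE : Module.finrank ℝ E = 3) {h : E → F'}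
    {n : WithTop ℕ∞} (hh : ContDiff ℝ n h) {c : ℝ} (hc : 0 < c) {i : ℕ} (hi : (i : WithTop ℕ∞) ≤ n) :
    ∫ x, ‖iteratedFDeriv ℝ i (fun y => h (c • y)) x‖ ^ 2 =
      c ^ (2 * i) * (c ^ 3)⁻¹ * ∫ x, ‖iteratedFDeriv ℝ i h x‖ ^ 2 := by
  have h1 : (fun x => ‖iteratedFDeriv ℝ i (fun y => h (c • y)) x‖ ^ 2) =
      fun x => c ^ (2 * i) * (fun y => ‖iteratedFDeriv ℝ i h y‖ ^ 2) (c • x) := by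
    funext x
    rw [norm_iteratedFDeriv_comp_smul hh c x hi, abs_of_pos hc, mul_pow, ← pow_mul, mul_comm i 2]
  have h2 : ∫ x, (fun y => ‖iteratedFDeriv ℝ i h y‖ ^ 2) (c • x) =
      (c ^ Module.finrank ℝ E)⁻¹ • ∫ x, ‖iteratedFDeriv ℝ i h x‖ ^ 2 :=
    Measure.integral_comp_smul_of_nonneg volume (fun y => ‖iteratedFDeriv ℝ i h y‖ ^ 2) c (hR := hc.le)
  rw [h1, integral_const_mul, h2, hE, smul_eq_mul, mul_assoc]

/-! ### The additive bound from the imbedding `H² ⊂ C_B` -/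

/-- `eLpNorm f 2 = ofReal √(∫‖f‖²)` for `f ∈ L²`. (Plumbing.) [folklore] -/
private theorem memLp_two_eLpNorm_eq_ofReal_sqrt {G : Type*} [NormedAddCommGroup G] {f : E → G}
    (hf : MemLp f 2 volume) : eLpNorm f 2 volume = ENNReal.ofReal (Real.sqrt (∫ x, ‖f x‖ ^ 2)) := by
  rw [MemLp.eLpNorm_eq_integral_rpow_norm (by norm_num) (by norm_num) hf, ENNReal.toReal_ofNat]
  have : ∫ x, ‖f x‖ ^ (2 : ℝ) = ∫ x, ‖f x‖ ^ 2 := integral_congr_ae (Eventually.of_forall fun x => Real.rpow_two _)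
  rw [this, Real.sqrt_eq_rpow, one_div]

/-- **`‖∇h(x)‖ ≤ K (‖Dh‖_{L²} + ‖D²h‖_{L²} + ‖D³h‖_{L²})`** in dimension three, one constant `K = K(E)` for all
`C³` fields with `Dh, D²h, D³h ∈ L²` (the imbedding `W^{2,2} ⊂ C_B` applied to `∇h`).
[cite: AdamsFournier2003, Thm. 4.12 Part I Case A (with m = p = 2, n = 3, applied to ∇h)] -/
theorem exists_norm_fderiv_le_add_dim_three [FiniteDimensional ℝ F'] (hE : Module.finrank ℝ E = 3) :
    ∃ K : ℝ, 0 ≤ K ∧ ∀ (h : E → F'), ContDiff ℝ 3 h →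
      MemLp (fun x => fderiv ℝ h x) 2 volume → MemLp (fun x => iteratedFDeriv ℝ 2 h x) 2 volume →
      MemLp (fun x => iteratedFDeriv ℝ 3 h x) 2 volume → ∀ x : E,
        ‖fderiv ℝ h x‖ ≤ K * (Real.sqrt (∫ y, ‖fderiv ℝ h y‖ ^ 2) + Real.sqrt (∫ y, ‖iteratedFDeriv ℝ 2 h y‖ ^ 2)
          + Real.sqrt (∫ y, ‖iteratedFDeriv ℝ 3 h y‖ ^ 2)) := by
  haveI : FiniteDimensional ℝ (E →L[ℝ] F') :=
    Module.Finite.equiv (LinearMap.toContinuousLinearMap : (E →ₗ[ℝ] F') ≃ₗ[ℝ] (E →L[ℝ] F'))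
  obtain ⟨K, hKtop, hK⟩ := FunctionSpaces.exists_enorm_le_sobolev_two_two_dim_three
    (E := E) (F := E →L[ℝ] F') (volume : Measure E) hE
  refine ⟨K.toReal, ENNReal.toReal_nonneg, fun h hh h1 h2 h3 x => ?_⟩
  have hg : ContDiff ℝ 2 (fun y => fderiv ℝ h y) := hh.fderiv_right (m := 2) (by norm_num)
  have hmain := hK (fun y => fderiv ℝ h y) hg x
  -- identify the three Sobolev norms of `∇h` with those of `h`
  have e : ∀ j : ℕ, eLpNorm (iteratedFDeriv ℝ j fun y => fderiv ℝ h y) 2 volume =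
      eLpNorm (fun y => iteratedFDeriv ℝ (j + 1) h y) 2 volume := fun j =>
    eLpNorm_congr_norm_ae (Eventually.of_forall fun y => norm_iteratedFDeriv_fderiv)
  have hm1 : MemLp (fun y => iteratedFDeriv ℝ 1 h y) 2 volume := by
    refine h1.of_le_mul (c := 1) ((hh.continuous_iteratedFDeriv (m := 1) (by norm_num)).aestronglyMeasurable)
      (Eventually.of_forall fun y => ?_)
    rw [one_mul, norm_iteratedFDeriv_one]
  set a₁ := Real.sqrt (∫ y, ‖fderiv ℝ h y‖ ^ 2) with ha₁
  set a₂ := Real.sqrt (∫ y, ‖iteratedFDeriv ℝ 2 h y‖ ^ 2)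
  set a₃ := Real.sqrt (∫ y, ‖iteratedFDeriv ℝ 3 h y‖ ^ 2)
  have ha₁' : ∫ y, ‖iteratedFDeriv ℝ 1 h y‖ ^ 2 = ∫ y, ‖fderiv ℝ h y‖ ^ 2 :=
    integral_congr_ae (Eventually.of_forall fun y => by
      show ‖iteratedFDeriv ℝ 1 h y‖ ^ 2 = ‖fderiv ℝ h y‖ ^ 2
      rw [norm_iteratedFDeriv_one])
  have hsum : ∑ j ∈ Finset.range 3, eLpNorm (iteratedFDeriv ℝ j fun y => fderiv ℝ h y) 2 volume =
      ENNReal.ofReal a₁ + ENNReal.ofReal a₂ + ENNReal.ofReal a₃ := by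
    simp only [Finset.sum_range_succ, Finset.sum_range_zero, zero_add, e]
    rw [memLp_two_eLpNorm_eq_ofReal_sqrt hm1, memLp_two_eLpNorm_eq_ofReal_sqrt h2, memLp_two_eLpNorm_eq_ofReal_sqrt h3, ha₁']
  rw [hsum, ← ENNReal.ofReal_add (Real.sqrt_nonneg _) (Real.sqrt_nonneg _),
    ← ENNReal.ofReal_add (add_nonneg (Real.sqrt_nonneg _) (Real.sqrt_nonneg _)) (Real.sqrt_nonneg _)] at hmain
  have hfin : K * ENNReal.ofReal (a₁ + a₂ + a₃) ≠ ⊤ := ENNReal.mul_ne_top hKtop.ne ENNReal.ofReal_ne_top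
  calc ‖fderiv ℝ h x‖ = (‖fderiv ℝ h x‖ₑ).toReal := (toReal_enorm _).symm
    _ ≤ (K * ENNReal.ofReal (a₁ + a₂ + a₃)).toReal := ENNReal.toReal_mono hfin hmain
    _ = K.toReal * (a₁ + a₂ + a₃) := by
        rw [ENNReal.toReal_mul, ENNReal.toReal_ofReal (by positivity)]

/-- `L²` membership of the derivatives of a dilate. (Plumbing.) [folklore] -/
private theorem memLp_iteratedFDeriv_comp_smul {h : E → F'} {n : WithTop ℕ∞} (hh : ContDiff ℝ n h)
    {c : ℝ} (hc : c ≠ 0) {i : ℕ} (hi : (i : WithTop ℕ∞) ≤ n)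
    (hg : MemLp (fun x => iteratedFDeriv ℝ i h x) 2 volume) :
    MemLp (fun x => iteratedFDeriv ℝ i (fun y => h (c • y)) x) 2 volume := by
  have hmap : Measure.map (fun x : E => c • x) volume =
      ENNReal.ofReal |(c ^ Module.finrank ℝ E)⁻¹| • (volume : Measure E) :=
    Measure.map_addHaar_smul volume hc
  have hg' : MemLp ((fun x => iteratedFDeriv ℝ i h x) ∘ fun x : E => c • x) 2 volume :=
    MemLp.comp_of_map (by rw [hmap]; exact hg.smul_measure ENNReal.ofReal_ne_top)
      (continuous_const_smul c).measurable.aemeasurable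
  have hhc : ContDiff ℝ n (fun y => h (c • y)) := hh.comp (contDiff_id.const_smul c)
  refine hg'.of_le_mul (c := |c| ^ i)
    ((hhc.continuous_iteratedFDeriv (m := i) hi).aestronglyMeasurable)
    (Eventually.of_forall fun x => ?_)
  rw [norm_iteratedFDeriv_comp_smul hh c x hi, Function.comp_apply]

/-- Continuous, square-integrable `g` with `∫‖g‖² = 0` vanishes identically. (Plumbing.) [folklore] -/
private theorem eq_zero_of_continuous_of_integral_norm_sq_eq_zero {G : Type*} [NormedAddCommGroup G] {g : E → G}
    (hg : Continuous g) (hi : Integrable (fun x => ‖g x‖ ^ 2) volume) (h0 : ∫ x, ‖g x‖ ^ 2 = 0)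
    (x : E) : g x = 0 := by
  have hae : (fun x => ‖g x‖ ^ 2) =ᵐ[volume] 0 :=
    (integral_eq_zero_iff_of_nonneg (fun x => sq_nonneg _) hi).1 h0
  have heq : (fun x => ‖g x‖ ^ 2) = 0 :=
    (Continuous.ae_eq_iff_eq volume (hg.norm.pow 2) continuous_const).1 hae
  have := congrFun heq x
  simp only [Pi.zero_apply, ne_eq, OfNat.ofNat_ne_zero, not_false_eq_true, pow_eq_zero_iff,
    norm_eq_zero] at this
  exact this

set_option maxHeartbeats 400000 in
/-- **Gagliardo–Nirenberg, three dimensions, `‖∇h‖_∞ ≤ C ‖h‖_{L²}^{1/6} ‖D³h‖_{L²}^{5/6}`**: there is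
`C = C(E)` such that for every `C³` field `h : E → F'` (`dim E = 3`) with `h, Dh, D²h, D³h ∈ L²` and every
`x`, `‖∇h(x)‖ ≤ C (∫‖h‖²)^{1/12} (∫‖D³h‖²)^{5/12}` — display (1.10) of C17 `Chae2007`. Proof: the additive
bound `exists_norm_fderiv_le_add_dim_three` applied to the dilates `h(μ² ·)`, the interpolation
inequalities of `WholeSpaceSobolevInterpolation`, and the choice `μ = (‖h‖₂/‖D³h‖₂)^{1/6}`.
[cite: Nirenberg1959, Lecture II, Theorem p. 125 (j = 1, p = ∞, m = 3, r = q = 2, n = 3)] -/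
theorem exists_norm_fderiv_le_gagliardoNirenberg_dim_three [FiniteDimensional ℝ F']
    (hE : Module.finrank ℝ E = 3) :
    ∃ C : ℝ, 0 ≤ C ∧ ∀ (h : E → F'), ContDiff ℝ 3 h → MemLp h 2 volume →
      MemLp (fun x => fderiv ℝ h x) 2 volume → MemLp (fun x => iteratedFDeriv ℝ 2 h x) 2 volume →
      MemLp (fun x => iteratedFDeriv ℝ 3 h x) 2 volume → ∀ x : E,
        ‖fderiv ℝ h x‖ ≤ C * (Real.sqrt (∫ y, ‖h y‖ ^ 2)) ^ (1 / 6 : ℝ)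
          * (Real.sqrt (∫ y, ‖iteratedFDeriv ℝ 3 h y‖ ^ 2)) ^ (5 / 6 : ℝ) := by
  obtain ⟨K, hK0, hK⟩ := exists_norm_fderiv_le_add_dim_three (E := E) (F' := F') hE
  refine ⟨13 * K, by positivity, fun h hh h0 h1 h2 h3 x₀ => ?_⟩
  -- the four `L²` quantities
  set a₀ := Real.sqrt (∫ y, ‖h y‖ ^ 2) with ha₀
  set a₁ := Real.sqrt (∫ y, ‖fderiv ℝ h y‖ ^ 2) with ha₁
  set a₂ := Real.sqrt (∫ y, ‖iteratedFDeriv ℝ 2 h y‖ ^ 2) with ha₂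
  set a₃ := Real.sqrt (∫ y, ‖iteratedFDeriv ℝ 3 h y‖ ^ 2) with ha₃
  have hI0 : 0 ≤ ∫ y, ‖h y‖ ^ 2 := integral_nonneg fun _ => sq_nonneg _
  have hI1 : 0 ≤ ∫ y, ‖fderiv ℝ h y‖ ^ 2 := integral_nonneg fun _ => sq_nonneg _
  have hI2 : 0 ≤ ∫ y, ‖iteratedFDeriv ℝ 2 h y‖ ^ 2 := integral_nonneg fun _ => sq_nonneg _
  have hI3 : 0 ≤ ∫ y, ‖iteratedFDeriv ℝ 3 h y‖ ^ 2 := integral_nonneg fun _ => sq_nonneg _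
  have ha₀0 : 0 ≤ a₀ := Real.sqrt_nonneg _
  have ha₁0 : 0 ≤ a₁ := Real.sqrt_nonneg _
  have ha₂0 : 0 ≤ a₂ := Real.sqrt_nonneg _
  have ha₃0 : 0 ≤ a₃ := Real.sqrt_nonneg _
  have hsq1 : a₁ ^ 2 = ∫ y, ‖fderiv ℝ h y‖ ^ 2 := Real.sq_sqrt hI1
  have hsq2 : a₂ ^ 2 = ∫ y, ‖iteratedFDeriv ℝ 2 h y‖ ^ 2 := Real.sq_sqrt hI2
  -- the interpolation inequalities (dimension three)
  have hh2 : ContDiff ℝ 2 h := hh.of_le (by norm_num)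
  have I1 : a₁ ^ 2 ≤ 3 * (a₀ * a₂) := by
    have := wholeSpace_integral_norm_fderiv_sq_le hh2 h0 h1 h2
    rw [hE] at this; push_cast at this; rwa [hsq1]
  have I2 : a₂ ^ 2 ≤ 9 * (a₁ * a₃) := by
    have := wholeSpace_integral_norm_iteratedFDeriv_two_sq_le hh h1 h2 h3
    rw [hE] at this; push_cast at this; rw [hsq2]; linarith
  -- degenerate case: `a₁ = 0` forces `∇h ≡ 0`
  have hi1 : Integrable (fun y => ‖fderiv ℝ h y‖ ^ 2) volume := (memLp_two_iff_integrable_sq_norm h1.1).1 h1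
  by_cases hdeg : a₀ = 0 ∨ a₃ = 0
  · have ha₁z : a₁ = 0 := by
      rcases hdeg with h0z | h3z
      · have : a₁ ^ 2 ≤ 0 := by rw [h0z] at I1; simpa using I1
        nlinarith
      · have ha₂z : a₂ = 0 := by
          have : a₂ ^ 2 ≤ 0 := by rw [h3z] at I2; simpa using I2
          nlinarith
        have : a₁ ^ 2 ≤ 0 := by rw [ha₂z] at I1; simpa using I1
        nlinarith
    have hint0 : ∫ y, ‖fderiv ℝ h y‖ ^ 2 = 0 := by
      rw [← hsq1, ha₁z]; ring
    have hD0 : fderiv ℝ h x₀ = 0 :=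
      eq_zero_of_continuous_of_integral_norm_sq_eq_zero (hh.continuous_fderiv (by norm_num)) hi1 hint0 x₀
    rw [hD0, norm_zero]
    positivity
  push Not at hdeg
  obtain ⟨ha₀ne, ha₃ne⟩ := hdeg
  have ha₀pos : 0 < a₀ := lt_of_le_of_ne ha₀0 (Ne.symm ha₀ne)
  have ha₃pos : 0 < a₃ := lt_of_le_of_ne ha₃0 (Ne.symm ha₃ne)
  -- `s = a₀^{1/6}`, `t = a₃^{1/6}`
  set s : ℝ := a₀ ^ (1 / 6 : ℝ) with hs
  set t : ℝ := a₃ ^ (1 / 6 : ℝ) with ht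
  have hs0 : 0 < s := Real.rpow_pos_of_pos ha₀pos _
  have ht0 : 0 < t := Real.rpow_pos_of_pos ha₃pos _
  have hs6 : s ^ 6 = a₀ := by
    rw [hs, ← Real.rpow_natCast, ← Real.rpow_mul ha₀0]; norm_num
  have ht6 : t ^ 6 = a₃ := by
    rw [ht, ← Real.rpow_natCast, ← Real.rpow_mul ha₃0]; norm_num
  have ht5 : t ^ 5 = a₃ ^ (5 / 6 : ℝ) := by
    rw [ht, ← Real.rpow_natCast, ← Real.rpow_mul ha₃0]; norm_num
  -- consequences of the interpolation inequalities: `a₁ ≤ 5 s⁴ t²`, `a₂ ≤ 7 s² t⁴`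
  have D1 : a₁ ≤ 5 * s ^ 4 * t ^ 2 := by
    have h4 : a₁ ^ 4 ≤ 81 * a₀ ^ 2 * a₃ * a₁ := by
      have e : a₁ ^ 4 = (a₁ ^ 2) ^ 2 := by ring
      calc a₁ ^ 4 = (a₁ ^ 2) ^ 2 := e
        _ ≤ (3 * (a₀ * a₂)) ^ 2 := pow_le_pow_left₀ (sq_nonneg _) I1 2
        _ = 9 * a₀ ^ 2 * a₂ ^ 2 := by ring
        _ ≤ 9 * a₀ ^ 2 * (9 * (a₁ * a₃)) := by gcongr
        _ = 81 * a₀ ^ 2 * a₃ * a₁ := by ring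
    rcases ha₁0.eq_or_lt with hz | hpos
    · rw [← hz]; positivity
    · have h3 : a₁ ^ 3 ≤ 81 * a₀ ^ 2 * a₃ := by
        have : a₁ ^ 3 * a₁ ≤ (81 * a₀ ^ 2 * a₃) * a₁ := by nlinarith
        exact le_of_mul_le_mul_right this hpos
      have h3' : a₁ ^ 3 ≤ (5 * s ^ 4 * t ^ 2) ^ 3 := by
        calc a₁ ^ 3 ≤ 81 * a₀ ^ 2 * a₃ := h3
          _ = 81 * (s ^ 6) ^ 2 * t ^ 6 := by rw [hs6, ht6]
          _ ≤ 125 * (s ^ 6) ^ 2 * t ^ 6 := by gcongr; norm_num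
          _ = (5 * s ^ 4 * t ^ 2) ^ 3 := by ring
      exact le_of_pow_le_pow_left₀ (by norm_num) (by positivity) h3'
  have D2 : a₂ ≤ 7 * s ^ 2 * t ^ 4 := by
    have h2' : a₂ ^ 2 ≤ (7 * s ^ 2 * t ^ 4) ^ 2 := by
      calc a₂ ^ 2 ≤ 9 * (a₁ * a₃) := I2
        _ ≤ 9 * ((5 * s ^ 4 * t ^ 2) * a₃) := by gcongr
        _ = 45 * s ^ 4 * t ^ 2 * t ^ 6 := by rw [ht6]; ring
        _ ≤ 49 * s ^ 4 * t ^ 2 * t ^ 6 := by gcongr; norm_num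
        _ = (7 * s ^ 2 * t ^ 4) ^ 2 := by ring
    exact le_of_pow_le_pow_left₀ two_ne_zero (by positivity) h2'
  -- the dilate `h(c ·)`, `c = μ²`, `μ = s / t`
  set μ : ℝ := s / t with hμ
  have hμ0 : 0 < μ := div_pos hs0 ht0
  set c : ℝ := μ ^ 2 with hc
  have hc0 : 0 < c := pow_pos hμ0 2
  set hc' : E → F' := fun y => h (c • y) with hhc'
  have hhc : ContDiff ℝ 3 hc' := hh.comp (contDiff_id.const_smul c)
  -- `L²` data of the dilate
  have h1c : MemLp (fun x => fderiv ℝ hc' x) 2 volume := by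
    have hm := memLp_iteratedFDeriv_comp_smul (i := 1) hh hc0.ne' (by norm_num)
      (by
        refine h1.of_le_mul (c := 1) ((hh.continuous_iteratedFDeriv (m := 1) (by norm_num)).aestronglyMeasurable)
          (Eventually.of_forall fun y => ?_)
        rw [one_mul, norm_iteratedFDeriv_one])
    refine hm.of_le_mul (c := 1) ((hhc.continuous_fderiv (by norm_num)).aestronglyMeasurable)
      (Eventually.of_forall fun y => ?_)
    rw [one_mul, ← norm_iteratedFDeriv_one]
  have h2c : MemLp (fun x => iteratedFDeriv ℝ 2 hc' x) 2 volume :=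
    memLp_iteratedFDeriv_comp_smul (i := 2) hh hc0.ne' (by norm_num) h2
  have h3c : MemLp (fun x => iteratedFDeriv ℝ 3 hc' x) 2 volume :=
    memLp_iteratedFDeriv_comp_smul (i := 3) hh hc0.ne' (by norm_num) h3
  -- the scaled norms
  have A1 : Real.sqrt (∫ y, ‖fderiv ℝ hc' y‖ ^ 2) = a₁ / μ := by
    have e : ∫ y, ‖fderiv ℝ hc' y‖ ^ 2 = ∫ y, ‖iteratedFDeriv ℝ 1 hc' y‖ ^ 2 :=
      integral_congr_ae (Eventually.of_forall fun y => by
        show ‖fderiv ℝ hc' y‖ ^ 2 = ‖iteratedFDeriv ℝ 1 hc' y‖ ^ 2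
        rw [norm_iteratedFDeriv_one])
    have e' : ∫ y, ‖iteratedFDeriv ℝ 1 h y‖ ^ 2 = ∫ y, ‖fderiv ℝ h y‖ ^ 2 :=
      integral_congr_ae (Eventually.of_forall fun y => by
        show ‖iteratedFDeriv ℝ 1 h y‖ ^ 2 = ‖fderiv ℝ h y‖ ^ 2
        rw [norm_iteratedFDeriv_one])
    rw [e, integral_norm_iteratedFDeriv_comp_smul_sq hE hh hc0 (i := 1) (by norm_num), e', ← hsq1]
    have : c ^ (2 * 1) * (c ^ 3)⁻¹ * a₁ ^ 2 = (a₁ / μ) ^ 2 := by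
      rw [hc]; field_simp; ring
    rw [this, Real.sqrt_sq (div_nonneg ha₁0 hμ0.le)]
  have A2 : Real.sqrt (∫ y, ‖iteratedFDeriv ℝ 2 hc' y‖ ^ 2) = μ * a₂ := by
    rw [integral_norm_iteratedFDeriv_comp_smul_sq hE hh hc0 (i := 2) (by norm_num), ← hsq2]
    have : c ^ (2 * 2) * (c ^ 3)⁻¹ * a₂ ^ 2 = (μ * a₂) ^ 2 := by
      rw [hc]; field_simp; ring
    rw [this, Real.sqrt_sq (mul_nonneg hμ0.le ha₂0)]
  have A3 : Real.sqrt (∫ y, ‖iteratedFDeriv ℝ 3 hc' y‖ ^ 2) = μ ^ 3 * a₃ := by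
    have hsq3 : a₃ ^ 2 = ∫ y, ‖iteratedFDeriv ℝ 3 h y‖ ^ 2 := Real.sq_sqrt hI3
    rw [integral_norm_iteratedFDeriv_comp_smul_sq hE hh hc0 (i := 3) (by norm_num), ← hsq3]
    have : c ^ (2 * 3) * (c ^ 3)⁻¹ * a₃ ^ 2 = (μ ^ 3 * a₃) ^ 2 := by
      rw [hc]; field_simp; ring
    rw [this, Real.sqrt_sq (mul_nonneg (pow_nonneg hμ0.le 3) ha₃0)]
  -- the additive bound for the dilate at `c⁻¹ • x₀`
  have hadd := hK hc' hhc h1c h2c h3c (c⁻¹ • x₀)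
  rw [A1, A2, A3] at hadd
  have hgrad : ‖fderiv ℝ hc' (c⁻¹ • x₀)‖ = c * ‖fderiv ℝ h x₀‖ := by
    rw [← norm_iteratedFDeriv_one, norm_iteratedFDeriv_comp_smul hh c _ (by norm_num),
      smul_inv_smul₀ hc0.ne', norm_iteratedFDeriv_one, abs_of_pos hc0, pow_one]
  rw [hgrad] at hadd
  -- `‖∇h(x₀)‖ ≤ K (a₁/μ³ + a₂/μ + μ a₃) ≤ 13 K s t⁵`
  have hkey : ‖fderiv ℝ h x₀‖ ≤ K * (a₁ / μ ^ 3 + a₂ / μ + μ * a₃) := by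
    have hc2 : c = μ ^ 2 := rfl
    have : c * ‖fderiv ℝ h x₀‖ ≤ c * (K * (a₁ / μ ^ 3 + a₂ / μ + μ * a₃)) := by
      calc c * ‖fderiv ℝ h x₀‖ ≤ K * (a₁ / μ + μ * a₂ + μ ^ 3 * a₃) := hadd
        _ = c * (K * (a₁ / μ ^ 3 + a₂ / μ + μ * a₃)) := by rw [hc2]; field_simp
    exact le_of_mul_le_mul_left this hc0
  have hT : a₁ / μ ^ 3 + a₂ / μ + μ * a₃ ≤ 13 * (s * t ^ 5) := by
    have e1 : a₁ / μ ^ 3 = a₁ * t ^ 3 / s ^ 3 := by rw [hμ]; field_simp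
    have e2 : a₂ / μ = a₂ * t / s := by rw [hμ]; field_simp
    have e3 : μ * a₃ = s * t ^ 5 := by rw [hμ, ← ht6]; field_simp
    have b1 : a₁ * t ^ 3 / s ^ 3 ≤ 5 * (s * t ^ 5) := by
      rw [div_le_iff₀ (pow_pos hs0 3)]
      calc a₁ * t ^ 3 ≤ (5 * s ^ 4 * t ^ 2) * t ^ 3 := by gcongr
        _ = 5 * (s * t ^ 5) * s ^ 3 := by ring
    have b2 : a₂ * t / s ≤ 7 * (s * t ^ 5) := by
      rw [div_le_iff₀ hs0]
      calc a₂ * t ≤ (7 * s ^ 2 * t ^ 4) * t := by gcongr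
        _ = 7 * (s * t ^ 5) * s := by ring
    rw [e1, e2, e3]; linarith
  -- assemble: `s t⁵ = a₀^{1/6} a₃^{5/6}`
  have hst : s * t ^ 5 = a₀ ^ (1 / 6 : ℝ) * a₃ ^ (5 / 6 : ℝ) := by rw [ht5]
  calc ‖fderiv ℝ h x₀‖ ≤ K * (a₁ / μ ^ 3 + a₂ / μ + μ * a₃) := hkey
    _ ≤ K * (13 * (s * t ^ 5)) := mul_le_mul_of_nonneg_left hT hK0
    _ = 13 * K * a₀ ^ (1 / 6 : ℝ) * a₃ ^ (5 / 6 : ℝ) := by rw [hst]; ring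

end Literature.Analysis.FluidPDE

end
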